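import Literature.Topology.FourManifolds.HomotopySpheresGroupThreeLeaves
import Literature.Topology.FourManifolds.HomotopySpheresInverseDischarge
import Literature.Topology.FourManifolds.HomotopySpheresInverseLeaves
import Literature.Topology.FourManifolds.HomotopySpheresIsMulExists
import Literature.Topology.FourManifolds.HCobordismTheoremProofs
import HarnessLib

/-!
# Kervaire–Milnor's Theorem 1.1: the discharges after `Θ₂ = 0` and Lemma 2.3

Topic `Literature/Topology/FourManifolds`, fact seat of
`Literature.Topology.FourManifolds.exists_commGroup_homotopySphereClass` (M. Kervaire, J. Milnor,
*Groups of homotopy spheres I*, Ann. of Math. (2) 77 (1963), Thm. 1.1, p. 504: "The h-cobordism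
classes of homotopy `n`-spheres form an abelian group under the connected sum operation"; the
tree's `Θₙ = HomotopySphereClass n` is the quotient by orientation-preserving diffeomorphism,
`n ≠ 0, 4`).  Everything in this file is **proved**; no named fact is introduced.

`HomotopySpheresGroupThreeLeaves.lean` derives the tree's fact from four named facts
(`exists_commGroup_homotopySphereClass_of_threeLeaves_of_three`): (L1) `Θ₂ = 0`
(`nonemptyDiffeomorphSphere_two`), (L2) the Poincaré conjecture
(`nonempty_diffeomorph_sphere_three`, instance `n = 3` only), (L3) the homotopy theory in the
proof of Lemma 2.3 (`NullCobordism.isHomotopyEquiv_compl_ball_of_contractibleSpace`) and (L4)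
Smale's h-cobordism theorem (`nonempty_diffeomorph_of_isHCobordant_of_five_le`, spc4.S15).  Two of
them have since become theorems of the tree:

* (L3) is `NullCobordism.isHomotopyEquiv_compl_ball_of_contractibleSpace_holds`
  (`HomotopySpheresInverseDischarge.lean`: Whitehead's theorem, the CW type of compact manifolds,
  Alexander duality);
* (L1) is `nonemptyDiffeomorphSphere_two_holds` (`SmoothPoincareTwoHolds.lean`: Assertion 6 of
  Milnor's proof of the First Cancellation Theorem 5.4, now the theorem
  `Cobordism.Milnor1965_cancellation_modelChart_holds`, fed into the tree's reduction
  `nonemptyDiffeomorphSphere_two_of_modelChart` — rearrangement and cancellation give a Morse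
  function with two critical points on a homotopy `2`-sphere, then the smooth Reeb theorem).

This file records the consequences, bottom-up:

* `Θ₂ = 0` in the language of `Θₙ`: `HomotopySphere.nonempty_diffeomorph_sphere_two`,
  `HomotopySphereClass.subsingleton_two`, `HomotopySphereClass.natCard_two` (`|Θ₂| = 1`, table
  p. 504) and `exists_commGroup_homotopySphereClass_two` (Thm. 1.1 in dimension `2`,
  unconditionally);
* the named facts of the decomposition that were waiting on `Θ₂ = 0` only, **discharged**:
  `HomotopySphere.contractibleSpace_compl_image_ball_holds` (a homotopy sphere with an open disc
  deleted is contractible; Kosinski VI §1, Kervaire–Milnor p. 507),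
  `HomotopySphere.contractibleSpace_compl_singleton_holds` (punctured homotopy spheres),
  `HomotopySphere.nonempty_homotopyEquiv_sphere_of_isConnectedSum_holds` (p. 505: "the sum of two
  homotopy `n`-spheres is a homotopy `n`-sphere"), `HomotopySphereClass.isMul_exists_holds`
  (products exist in `Θₙ`; fact of `HomotopySpheres.lean`),
  `HomotopySphere.exists_isOrientedConnectedSum_neg_boundsContractible_holds` and
  `HomotopySphere.boundsContractible_of_isOrientedConnectedSum_neg_holds` (**Lemma 2.4**: `M # (-M)`
  bounds a contractible manifold), and — with (L3) — 
  `HomotopySphere.isHCobordant_sphere_of_isOrientedConnectedSum_neg_holds` (`Σ # (-Σ)` is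
  h-cobordant to `Sⁿ`, Lemmas 2.3–2.4 as used in the proof of Thm. 1.1, p. 507);
* `HomotopySphereClass.groupLawFacts_of_hCobordism`,
  `exists_commGroup_homotopySphereClass_of_ne_three_of_hCobordism` — **Theorem 1.1 for
  diffeomorphism classes in the dimensions covered by the source (`n ≠ 0, 3, 4`) from ONE named
  fact, Smale's h-cobordism theorem** (spc4.S15; Kervaire–Milnor, Remark p. 505);
* `exists_commGroup_homotopySphereClass_of_hCobordism_of_poincare` — **the tree's fact
  (`n ≠ 0, 4`) from Smale's h-cobordism theorem and the Poincaré conjecture** (spc4.S31,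
  Perelman; needed by the instance `n = 3` only, which asserts inverses in the diffeomorphism
  quotient of homotopy `3`-spheres and which Kervaire–Milnor record as open, p. 507: "If the
  Poincaré hypothesis were proved, it would follow that `Θ₃` is zero; but at present the
  structure of `Θ₃` remains unknown").

The discharge `exists_commGroup_homotopySphereClass_holds` is the last theorem applied to
`nonempty_diffeomorph_of_isHCobordant_of_five_le_holds` and `nonempty_diffeomorph_sphere_three_holds`
once those land; the source-faithful variant `exists_commGroup_homotopySphereClass_of_ne_three`
(`HomotopySpheresGroupLeaves.lean`) needs the first only.

## References

* M. Kervaire, J. Milnor, *Groups of homotopy spheres I*, Ann. of Math. (2) 77 (1963), 504–537: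
  Thm. 1.1 and table (p. 504), Remark (p. 505), Lemmas 2.1–2.4 and proof of Thm. 1.1
  (pp. 505–507). doi:10.2307/1970128 [KervaireMilnorAnnals1963]
* J. Milnor, *Lectures on the h-cobordism theorem*, Princeton (1965), proof of Thm. 5.4
  (Assertion 6), Thm. 9.1. [MilnorHCobordism1965]
* A. Kosinski, *Differential Manifolds*, Academic Press (1993), Ch. VI §1. [Kosinski1993]
* J. Morgan, G. Tian, *Ricci Flow and the Poincaré Conjecture*, Clay Math. Monogr. 3 (2007),
  Cor. 0.2 (a). [MorganTian2007]
-/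

open scoped Manifold ContDiff Topology
open Set

noncomputable section

namespace Literature.Topology.FourManifolds

/-! ### `Θ₂ = 0` in the language of `Θₙ` -/

/-- `Θ₂ = 0` at universe `0` (Kervaire–Milnor 1963, p. 507), the form consumed below: the tree's
reduction `nonemptyDiffeomorphSphere_two_of_modelChart` fed with the theorem
`Cobordism.Milnor1965_cancellation_modelChart_holds`.  A local copy of
`nonemptyDiffeomorphSphere_two_univ_zero` / `nonemptyDiffeomorphSphere_two_holds`
(`SmoothPoincareTwoHolds.lean`, the discharge at every universe), kept private so that this file
does not depend on that sibling. [cite: KervaireMilnorAnnals1963, §2 p. 507] [cite: MilnorHCobordism1965, proof of Thm. 5.4 (Assertion 6)] -/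
private theorem nonemptyDiffeomorphSphere_two_zero : nonemptyDiffeomorphSphere_two.{0} :=
  nonemptyDiffeomorphSphere_two_of_modelChart Cobordism.Milnor1965_cancellation_modelChart_holds

/-- **Every homotopy `2`-sphere is diffeomorphic to `𝕊²`** (Kervaire–Milnor 1963, p. 507:
`Θ₂ = 0`), the instance of the theorem `nonemptyDiffeomorphSphere_two_holds`
(`SmoothPoincareTwoHolds.lean`) for the carriers of the tree's `HomotopySphere 2`. [cite: KervaireMilnorAnnals1963, §2 p. 507] -/
theorem HomotopySphere.nonempty_diffeomorph_sphere_two (S : HomotopySphere 2) :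
    Nonempty (S.carrier ≃ₘ⟮𝓡 2, 𝓡 2⟯ (Metric.sphere (0 : EuclideanSpace ℝ (Fin (2 + 1))) 1)) :=
  HomotopySphere.nonempty_diffeomorph_sphere_of_le_two nonemptyDiffeomorphSphere_two_zero 2 S
    (by norm_num) le_rfl

/-- **`Θ₂ = 0`**: the oriented-diffeomorphism classes of homotopy `2`-spheres form a single point
(Kervaire–Milnor 1963, p. 504: "It is clear that `Θ₁ = Θ₂ = 0`"; p. 507), by
`HomotopySphere.nonempty_diffeomorph_sphere_two` and
`HomotopySphereClass.subsingleton_of_nonempty_diffeomorph_sphere` (a diffeomorphism to `𝕊²` either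
preserves or reverses the orientations, and `[𝕊², -o] = [𝕊², o]`). [cite: KervaireMilnorAnnals1963, p. 504 and §2 p. 507] -/
theorem HomotopySphereClass.subsingleton_two : Subsingleton (HomotopySphereClass 2) :=
  HomotopySphereClass.subsingleton_of_nonempty_diffeomorph_sphere two_ne_zero
    HomotopySphere.nonempty_diffeomorph_sphere_two

/-- **`|Θ₂| = 1`** (Kervaire–Milnor 1963, table p. 504, second entry), in the counting form used
for the orders `|Θₙ|` elsewhere in the tree. [cite: KervaireMilnorAnnals1963, table p. 504] -/
theorem HomotopySphereClass.natCard_two : Nat.card (HomotopySphereClass 2) = 1 := by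
  obtain ⟨o₀⟩ := (isOrientable_sphere_holds 2 : Nonempty _)
  haveI := HomotopySphereClass.subsingleton_two
  exact Nat.card_eq_one_iff_unique.2
    ⟨inferInstance, ⟨HomotopySphereClass.mk (HomotopySphere.sphere o₀)⟩⟩

/-- **Kervaire–Milnor's Theorem 1.1 in dimension `2`, unconditionally**: `Θ₂` carries a
commutative group structure whose multiplication is the connected sum, whose unit is `[𝕊²]` with
any orientation and whose inverse is orientation reversal — the instance `n = 2` of the named fact
`exists_commGroup_homotopySphereClass`, now a theorem (`Θ₂` is a point and the trivial group does
it, `HomotopySphereClass.exists_commGroup_of_subsingleton`). [cite: KervaireMilnorAnnals1963, Thm. 1.1 and §2 p. 507] -/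
theorem exists_commGroup_homotopySphereClass_two :
    ∃ _ : CommGroup (HomotopySphereClass 2),
      (∀ a b c : HomotopySphereClass 2, HomotopySphereClass.IsMul a b c → a * b = c) ∧
      (∀ o : SmoothOrientation (𝓡 2) (Metric.sphere (0 : EuclideanSpace ℝ (Fin (2 + 1))) 1),
        (HomotopySphereClass.mk ⟨Metric.sphere (0 : EuclideanSpace ℝ (Fin (2 + 1))) 1, o,
          ⟨.refl _⟩⟩ : HomotopySphereClass 2) = 1) ∧
      ∀ a : HomotopySphereClass 2, a⁻¹ = a.neg := by
  obtain ⟨o₀⟩ := (isOrientable_sphere_holds 2 : Nonempty _)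
  haveI := HomotopySphereClass.subsingleton_two
  exact HomotopySphereClass.exists_commGroup_of_subsingleton o₀

/-! ### Punctured homotopy spheres, sums of homotopy spheres, products in `Θₙ` — discharged -/

/-- **A homotopy sphere with an open disc deleted is contractible — discharged**: the named fact
`HomotopySphere.contractibleSpace_compl_image_ball` of `HomotopySpheresSum.lean` (Kosinski,
*Differential Manifolds* (1993), VI §1, remark before Cor. 1.4; Kervaire–Milnor 1963, proof of
Lemma 2.4, p. 507: "`W` contains `M - Interior i(½Dⁿ)` as deformation retract, and therefore is
contractible"), by `HomotopySphere.contractibleSpace_compl_image_ball_of_sphere_two` (dimensions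
`0, 1` directly, dimension `2` from `Θ₂ = 0`, dimensions `≥ 3` from the Hurewicz theorem by the ENR
route) fed with `nonemptyDiffeomorphSphere_two_holds`. [cite: Kosinski1993, Ch. VI §1 (remark before Cor. 1.4)] [cite: KervaireMilnorAnnals1963, Lemma 2.4, proof (p. 507)] -/
theorem HomotopySphere.contractibleSpace_compl_image_ball_holds :
    HomotopySphere.contractibleSpace_compl_image_ball :=
  HomotopySphere.contractibleSpace_compl_image_ball_of_sphere_two
    nonemptyDiffeomorphSphere_two_zero

/-- **A punctured homotopy sphere `Σ ∖ {p}`, `dim Σ ≥ 2`, is contractible — discharged**: the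
named fact `HomotopySphere.contractibleSpace_compl_singleton` of `HomotopySpheresInverse.lean`
(the homotopy theory in Kervaire–Milnor's proof of Lemma 2.4, p. 507), from the disc-complement
form by the deformation retraction of `Σ ∖ {p}` onto `Σ ∖ i(B̊ⁿ)`
(`HomotopySphere.contractibleSpace_compl_singleton_of_compl_image_ball`). [cite: KervaireMilnorAnnals1963, Lemma 2.4, proof (p. 507)] -/
theorem HomotopySphere.contractibleSpace_compl_singleton_holds :
    HomotopySphere.contractibleSpace_compl_singleton :=
  HomotopySphere.contractibleSpace_compl_singleton_of_compl_image_ball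
    HomotopySphere.contractibleSpace_compl_image_ball_holds

/-- **"It is clear that the sum of two homotopy `n`-spheres is a homotopy `n`-sphere" —
discharged**: the named fact `HomotopySphere.nonempty_homotopyEquiv_sphere_of_isConnectedSum` of
`HomotopySpheresGroup.lean` (Kervaire–Milnor 1963, §2, p. 505), by the suspension argument
`HomotopySphere.nonempty_homotopyEquiv_sphere_of_isConnectedSum_of` (`HomotopySpheresSum.lean`)
over the contractibility of the two disc complements. [cite: KervaireMilnorAnnals1963, §2 (p. 505)] -/
theorem HomotopySphere.nonempty_homotopyEquiv_sphere_of_isConnectedSum_holds :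
    HomotopySphere.nonempty_homotopyEquiv_sphere_of_isConnectedSum :=
  HomotopySphere.nonempty_homotopyEquiv_sphere_of_isConnectedSum_of
    HomotopySphere.contractibleSpace_compl_image_ball_holds

namespace HomotopySphereClass

variable {n : ℕ}

/-- **Products exist in `Θₙ` — discharged**: the named fact `HomotopySphereClass.isMul_exists` of
`HomotopySpheres.lean` (any two classes of `Θₙ`, `n ≠ 0`, have a connected sum `IsMul a b c`;
Kervaire–Milnor 1963, §2 p. 505: oriented connected sums exist — the tree theorem
`exists_isOrientedConnectedSum_holds` — and the sum of two homotopy spheres is a homotopy sphere),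
by `isMul_exists_of_contractibleSpace_compl_image_ball` (`HomotopySpheresIsMulExists.lean`).
[cite: KervaireMilnorAnnals1963, §2 (p. 505), Lemma 2.2 ff.] -/
theorem isMul_exists_holds : isMul_exists (n := n) :=
  isMul_exists_of_contractibleSpace_compl_image_ball
    HomotopySphere.contractibleSpace_compl_image_ball_holds

end HomotopySphereClass

/-! ### Lemma 2.4 and `Σ # (-Σ) ∼ₕ Sⁿ` — discharged -/

/-- **Kervaire–Milnor's Lemma 2.4, existential form — discharged**: for every homotopy
`n`-sphere `(Σ, o)`, `n ≥ 2`, some oriented connected sum of `(Σ, o)` and `(Σ, -o)` bounds a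
contractible manifold (named fact `HomotopySphere.exists_isOrientedConnectedSum_neg_boundsContractible`
of `HomotopySpheresInverse.lean`; *Groups of homotopy spheres I* (1963), Lemma 2.4 and its proof,
p. 507), from the rotation construction (theorem
`HomotopySphere.exists_nullCobordism_isOrientedConnectedSum_neg_holds`) and the contractibility of
punctured homotopy spheres (`HomotopySphere.contractibleSpace_compl_singleton_holds`).
[cite: KervaireMilnorAnnals1963, Lemma 2.4 (p. 507), proof] -/
theorem HomotopySphere.exists_isOrientedConnectedSum_neg_boundsContractible_holds :
    HomotopySphere.exists_isOrientedConnectedSum_neg_boundsContractible :=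
  HomotopySphere.exists_isOrientedConnectedSum_neg_boundsContractible_of
    HomotopySphere.exists_nullCobordism_isOrientedConnectedSum_neg_holds
    HomotopySphere.contractibleSpace_compl_singleton_holds

/-- **Kervaire–Milnor's Lemma 2.4 — discharged**: "If `M` is a homotopy sphere, then `M # (-M)`
bounds a contractible manifold" (*Groups of homotopy spheres I* (1963), Lemma 2.4, p. 507), for
every oriented connected sum `M # (-M)` of a homotopy `n`-sphere, `n ≥ 2` (named fact
`HomotopySphere.boundsContractible_of_isOrientedConnectedSum_neg` of `HomotopySpheresInverse.lean`),
by `HomotopySphere.boundsContractible_of_isOrientedConnectedSum_neg_of_compl_singleton` (the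
existential form and the Palais–Cerf uniqueness of oriented connected sums, Lemma 2.1, both
theorems). [cite: KervaireMilnorAnnals1963, Lemma 2.4 (p. 507), with Lemma 2.1 (p. 505)] -/
theorem HomotopySphere.boundsContractible_of_isOrientedConnectedSum_neg_holds :
    HomotopySphere.boundsContractible_of_isOrientedConnectedSum_neg :=
  HomotopySphere.boundsContractible_of_isOrientedConnectedSum_neg_of_compl_singleton
    HomotopySphere.contractibleSpace_compl_singleton_holds

/-- **`Σ # (-Σ)` is h-cobordant to `𝕊ⁿ` (`n ≥ 2`) — discharged**: the named fact
`HomotopySphere.isHCobordant_sphere_of_isOrientedConnectedSum_neg` of `HomotopySpheresGroup.lean`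
(Kervaire–Milnor 1963, proof of Thm. 1.1, p. 507: "By Lemmas 2.3, 2.4, each element of `Θₙ` has
an inverse"), by `HomotopySphere.isHCobordant_sphere_of_isOrientedConnectedSum_neg_of_twoLeaves`
fed with the two discharges `NullCobordism.isHomotopyEquiv_compl_ball_of_contractibleSpace_holds`
(homotopy theory of Lemma 2.3) and `HomotopySphere.contractibleSpace_compl_image_ball_holds`.
[cite: KervaireMilnorAnnals1963, Lemmas 2.3–2.4 and proof of Thm. 1.1 (pp. 506–507)] -/
theorem HomotopySphere.isHCobordant_sphere_of_isOrientedConnectedSum_neg_holds :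
    HomotopySphere.isHCobordant_sphere_of_isOrientedConnectedSum_neg :=
  HomotopySphere.isHCobordant_sphere_of_isOrientedConnectedSum_neg_of_twoLeaves
    NullCobordism.isHomotopyEquiv_compl_ball_of_contractibleSpace_holds
    HomotopySphere.contractibleSpace_compl_image_ball_holds

/-! ### Theorem 1.1 from Smale's h-cobordism theorem alone -/

/-- **The class-level group laws of `Θₙ`, `n ≥ 5`, from Smale's h-cobordism theorem alone**:
`HomotopySphereClass.GroupLawFacts n` (products exist, are unique and associative, `[𝕊ⁿ]` is a unit,
`[Σ] # [-Σ] = [𝕊ⁿ]`; Kervaire–Milnor 1963, Lemmas 2.1–2.4) by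
`HomotopySphereClass.groupLawFacts_of_fourFacts`, its inputs "sums of homotopy spheres are homotopy
spheres" and "`Σ # (-Σ) ∼ₕ Sⁿ`" being the discharges above; the remaining hypothesis is spc4.S15
(`nonempty_diffeomorph_of_isHCobordant_of_five_le`: h-cobordant simply connected closed manifolds of
dimension `≥ 5` are diffeomorphic; Smale 1962, Milnor 1965 Thm. 9.1; Kervaire–Milnor, Remark p. 505).
[cite: KervaireMilnorAnnals1963, §2 (Lemmas 2.1–2.4, pp. 505–507) and Remark p. 505] [cite: MilnorHCobordism1965, Thm. 9.1] -/
theorem HomotopySphereClass.groupLawFacts_of_hCobordism {n : ℕ} (h5 : 5 ≤ n)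
    (hS15 : FourManifolds.nonempty_diffeomorph_of_isHCobordant_of_five_le.{0}) :
    HomotopySphereClass.GroupLawFacts n :=
  HomotopySphereClass.groupLawFacts_of_fourFacts h5
    HomotopySphere.nonempty_homotopyEquiv_sphere_of_isConnectedSum_holds
    HomotopySphere.isHCobordant_sphere_of_isOrientedConnectedSum_neg_holds hS15

/-- **Kervaire–Milnor's Theorem 1.1 for diffeomorphism classes in the dimensions covered by the
source (`n ≠ 0, 3, 4`), from ONE named fact — Smale's h-cobordism theorem.**  The named fact
`exists_commGroup_homotopySphereClass_of_ne_three` (`HomotopySpheresGroupLeaves.lean`: for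
`n ≠ 0, 3, 4`, `Θₙ = HomotopySphereClass n` is a commutative group under connected sum with unit
`[𝕊ⁿ]`, any orientation, and inverse `[-Σ]`) follows from spc4.S15
(`nonempty_diffeomorph_of_isHCobordant_of_five_le`) by
`exists_commGroup_homotopySphereClass_of_ne_three_of_threeLeaves`, the other two leaves being the
theorems `nonemptyDiffeomorphSphere_two_holds` (`Θ₂ = 0`, p. 507) and
`NullCobordism.isHomotopyEquiv_compl_ball_of_contractibleSpace_holds` (Lemma 2.3).  Kervaire–Milnor
prove Thm. 1.1 for h-cobordism classes and pass to diffeomorphism classes for `n ≠ 3, 4` by Smale's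
theorem (Remark, p. 505), which is exactly the remaining hypothesis.
[cite: KervaireMilnorAnnals1963, Thm. 1.1 (p. 504), Remark p. 505, §2 pp. 505–507] [cite: MilnorHCobordism1965, Thm. 9.1] -/
theorem exists_commGroup_homotopySphereClass_of_ne_three_of_hCobordism
    (hS15 : FourManifolds.nonempty_diffeomorph_of_isHCobordant_of_five_le.{0}) :
    exists_commGroup_homotopySphereClass_of_ne_three :=
  exists_commGroup_homotopySphereClass_of_ne_three_of_threeLeaves nonemptyDiffeomorphSphere_two_zero
    NullCobordism.isHomotopyEquiv_compl_ball_of_contractibleSpace_holds hS15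

/-- **The tree's fact `exists_commGroup_homotopySphereClass` (`n ≠ 0, 4`) from Smale's h-cobordism
theorem and the Poincaré conjecture.**  GIVEN spc4.S15
(`nonempty_diffeomorph_of_isHCobordant_of_five_le`; Smale, Milnor 1965 Thm. 9.1) and spc4.S31
(`nonempty_diffeomorph_sphere_three`: a closed simply connected smooth `3`-manifold is diffeomorphic
to `S³`; Perelman, Morgan–Tian 2007 Cor. 0.2 (a)), `Θₙ` is a commutative group under connected sum
with unit `[𝕊ⁿ]` and inverse `[-Σ]` for every `n ≠ 0, 4`
(`exists_commGroup_homotopySphereClass_of_threeLeaves_of_three` with the discharges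
`nonemptyDiffeomorphSphere_two_holds` and
`NullCobordism.isHomotopyEquiv_compl_ball_of_contractibleSpace_holds`).  The Poincaré conjecture
enters through the instance `n = 3` only (inverses in the diffeomorphism quotient of homotopy
`3`-spheres force `Σ # (-Σ) ≅ S³`), which is beyond the cited source: Kervaire–Milnor, p. 507,
"If the Poincaré hypothesis were proved, it would follow that `Θ₃` is zero; but at present the
structure of `Θ₃` remains unknown."
[cite: KervaireMilnorAnnals1963, Thm. 1.1 (p. 504), §2 pp. 505–507] [cite: MilnorHCobordism1965, Thm. 9.1] [cite: MorganTian2007, Cor. 0.2 (a)] -/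
theorem exists_commGroup_homotopySphereClass_of_hCobordism_of_poincare
    (hS15 : FourManifolds.nonempty_diffeomorph_of_isHCobordant_of_five_le.{0})
    (h3 : FourManifolds.nonempty_diffeomorph_sphere_three.{0}) :
    exists_commGroup_homotopySphereClass :=
  exists_commGroup_homotopySphereClass_of_threeLeaves_of_three nonemptyDiffeomorphSphere_two_zero
    h3 NullCobordism.isHomotopyEquiv_compl_ball_of_contractibleSpace_holds hS15

end Literature.Topology.FourManifolds

end
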